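import Mathlib
import Summits.KontsevichZagierPeriods.KontsevichZagierPeriods.Theorems.TorsionLogsNeronTorsionSectorStubTranslationStep
import Summits.KontsevichZagierPeriods.KontsevichZagierPeriods.Theorems.TorsionLogsNeronTorsionSectorStubSigmaChart
import HarnessLib

/-!
# Stub `stub_wStepInst` — crux `TorsionLogs.NeronTorsionSector`, line `registered` (block S4):
# the corner step through the point at infinity

Entirely in the compactifying chart `s = x^(-1/2)` of the real curve `y² = f(x) = 4x³ − g₂x − g₃`
(`s ∈ (0, s₁)`, `s₁² x₁ = 1`, `√f(s⁻²) = R(s)/s³` with `R > 0` continuous and `ℚ`-semialgebraic on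
`[0, s₁]`). The transposed row-`0` half-cell `t̂′₀ = [{0 < s′ < s < s₁}, ĥ(s′)(2/R s)(2/R s′)]`
(`ĥ(s) = (g₂s² + 2g₃s⁴)/4`, the second-kind density `h(x) = (g₂x + 2g₃)/(4x²)` in the chart) is
compared with the row-`0` half-cell `t̂₀ = [{0 < s < s′ < s₁}, same integrand]`:
`[t̂₀] − [t̂′₀] − [(0,s₁), (Q̂⁺(0) − Q̂⁺(s))·2/R(s)] ∈ KZ.relations`, where `Q̂⁺ = Qfp ∘ (s ↦ s⁻²)` is
the chart potential of the upper branch.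

This is ONE application of the landed generic translation step `stub_translationStep` with
`φ = ψ = σ`, the chart translation of the upper branch (a strictly decreasing bijection of
`(0, s₁)` with the chart Haar identity `|σ′|·R = R∘σ`), weights `w = u = 2/R`, kernels
`kS = kT = ĥ`, fibres `(0, s)` and potential `Q̂⁺`; the derivative of `Q̂⁺` along the fibres is
obtained by the chain rule from `Qfp′ = (h∘τp − h)/√f` and `(σ s)⁻² = τp(s⁻²)`
(`wStepInst_hasDerivAt_chart`), and the image of the source domain under `σ × σ` is the target
domain because `σ` reverses the order (`wStepInst_image_domain`).

References: M. Kontsevich, D. Zagier, *Periods* (2001), §1.2 rules (1)–(3).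
-/

noncomputable section

-- `Summit.KontsevichZagierPeriods.KontsevichZagierPeriods.…` is the tree's mandated layout (single-conjunct summit).
set_option linter.dupNamespace false

open Set MeasureTheory MvPolynomial Filter Topology
open Literature.NumberTheory.Transcendental Literature.ModelTheory.ExponentialFields

namespace Summit.KontsevichZagierPeriods.KontsevichZagierPeriods.Cruxes.NeronTorsionSector.Translation

/-- **The chain rule for the chart potential of the upper branch.** If `Q̂⁺ = Qfp ∘ (s ↦ s⁻²)` on
`(0, s₁)` (`s₁² x₁ = 1`), `Qfp′(x) = (h(τp x) − h(x))/√f(x)` on `(x₁, ∞)` with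
`h(x) = (g₂x + 2g₃)/(4x²)`, `√f(s⁻²) = R(s)/s³` and `(σ s)⁻² = τp(s⁻²)`, then
`Q̂⁺′(s) = −(ĥ(σ s) − ĥ(s))·2/R(s)` on `(0, s₁)`, `ĥ(s) = (g₂s² + 2g₃s⁴)/4`.
[cite: KontsevichZagier2001, §1.2] -/
theorem wStepInst_hasDerivAt_chart {g₂ g₃ x₁ s₁ : ℝ} {f τp Qfp R σ Qhp : ℝ → ℝ}
    (hsx : s₁ ^ 2 * x₁ = 1)
    (hR : ∀ s, 0 < s → s ≤ s₁ → Real.sqrt (f (s ^ 2)⁻¹) = R s / s ^ 3)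
    (hRpos : ∀ s ∈ Icc 0 s₁, 0 < R s)
    (hσI : ∀ s ∈ Ioo 0 s₁, σ s ∈ Ioo 0 s₁)
    (hchart : ∀ s, 0 < s → s < s₁ → Qhp s = Qfp (s ^ 2)⁻¹ ∧ (σ s ^ 2)⁻¹ = τp (s ^ 2)⁻¹)
    (hQfp : ∀ x, x₁ < x → HasDerivAt Qfp
      (((g₂ * τp x + 2 * g₃) / (4 * τp x ^ 2) - (g₂ * x + 2 * g₃) / (4 * x ^ 2)) / Real.sqrt (f x)) x)
    {s : ℝ} (hs : s ∈ Ioo 0 s₁) :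
    HasDerivAt Qhp (-(((g₂ * σ s ^ 2 + 2 * g₃ * σ s ^ 4) / 4 - (g₂ * s ^ 2 + 2 * g₃ * s ^ 4) / 4)
      * (2 / R s))) s := by
  -- adapted from `logB_hasDerivAt_chart` (TorsionLogsNeronTorsionSectorStubLogB)
  have hs0 : (0 : ℝ) < s := hs.1
  have hx : x₁ < (s ^ 2)⁻¹ := sigmaChart_lt_inv_sq hsx hs0 hs.2
  obtain ⟨-, hστ⟩ := hchart s hs0 hs.2
  have hcomp := (hQfp _ hx).comp s (sigmaChart_hasDerivAt_inv_sq hs0.ne')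
  have hev : Qhp =ᶠ[𝓝 s] (Qfp ∘ fun t : ℝ => (t ^ 2)⁻¹) :=
    Filter.eventuallyEq_of_mem (Ioo_mem_nhds hs0 hs.2) fun y hy => (hchart y hy.1 hy.2).1
  refine (hcomp.congr_of_eventuallyEq hev).congr_deriv ?_
  rw [hR s hs0 hs.2.le, ← hστ]
  have hR0 : R s ≠ 0 := (hRpos s ⟨hs0.le, hs.2.le⟩).ne'
  have hs0' : s ≠ 0 := hs0.ne'
  have hσ0 : σ s ≠ 0 := (hσI s hs).1.ne'
  field_simp

/-- **The chart translation `σ × σ` maps the transposed half-cell onto the half-cell.** If `σ` is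
strictly decreasing on `[0, s₁]` with `σ((0, s₁)) = (0, s₁)`, then
`(σ × σ)({0 < z₁ < z₀ < s₁}) = {0 < w₀ < w₁ < s₁}`. [cite: KontsevichZagier2001, §1.2] -/
theorem wStepInst_image_domain {s₁ : ℝ} {σ : ℝ → ℝ} (hanti : StrictAntiOn σ (Icc 0 s₁))
    (himg : σ '' Ioo 0 s₁ = Ioo 0 s₁) :
    {w : Fin 2 → ℝ | 0 < w 0 ∧ w 0 < w 1 ∧ w 1 < s₁} =
      (fun z : Fin 2 → ℝ => (![σ (z 0), σ (z 1)] : Fin 2 → ℝ)) ''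
        {z : Fin 2 → ℝ | (0 < z 0 ∧ z 0 < s₁) ∧ 0 < z 1 ∧ z 1 < z 0} := by
  have hσI : ∀ s ∈ Ioo 0 s₁, σ s ∈ Ioo 0 s₁ := fun s hs => by
    rw [← himg]
    exact mem_image_of_mem σ hs
  ext w
  simp only [mem_setOf_eq, mem_image]
  constructor
  · rintro ⟨h0, h01, h1⟩
    have hw0 : w 0 ∈ σ '' Ioo 0 s₁ := by
      rw [himg]
      exact ⟨h0, h01.trans h1⟩
    have hw1 : w 1 ∈ σ '' Ioo 0 s₁ := by
      rw [himg]
      exact ⟨h0.trans h01, h1⟩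
    obtain ⟨a, ha, hσa⟩ := hw0
    obtain ⟨b, hb, hσb⟩ := hw1
    have hba : b < a := by
      have h : σ a < σ b := by rwa [hσa, hσb]
      exact (hanti.lt_iff_gt (Ioo_subset_Icc_self ha) (Ioo_subset_Icc_self hb)).1 h
    refine ⟨![a, b], ⟨⟨ha.1, ha.2⟩, hb.1, hba⟩, ?_⟩
    ext i
    fin_cases i
    · simpa using hσa
    · simpa using hσb
  · rintro ⟨z, ⟨⟨hz0, hz0s⟩, hz1, hz10⟩, rfl⟩
    have hz1s : z 1 < s₁ := hz10.trans hz0s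
    have hσ0 := hσI (z 0) ⟨hz0, hz0s⟩
    have hσ1 := hσI (z 1) ⟨hz1, hz1s⟩
    have hlt : σ (z 0) < σ (z 1) :=
      hanti ⟨hz1.le, hz1s.le⟩ ⟨hz0.le, hz0s.le⟩ hz10
    simp only [Matrix.cons_val_zero, Matrix.cons_val_one]
    exact ⟨hσ0.1, hlt, hσ1.2⟩

/-- **STUB S4 (`stub_wStepInst`) — the corner step through the point at infinity,
`t̂_0 ≡ t̂′_0 + [(0,s₁), (q₀ − Q̂⁺)·2/R]`.** Entirely in the chart `s = x^{-1/2}`: source the transposed row-0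
half-cell `t̂′_0 = [{0 < s′ < s < s₁}, ĥ(s′)(2/R s)(2/R s′)]`, target `t̂_0 = [{0 < s < s′ < s₁}, same]`;
`stub_translationStep` with `φ = ψ = σ` (chart translation of the upper branch: a decreasing bijection of `(0,s₁)`,
Haar `|σ′|R = R∘σ`, `σ′ := deriv σ`), weights `w = u = 2/R`, kernels `kS = kT = ĥ`, fibres `(0, s)`, potential
`Q = Q̂⁺` (`= Qfp(s⁻²)`, continuous on `[0,s₁)`; chain rule from `Qfp′ = (h∘τp − h)/√f` and `ĥ∘σ = h∘τp∘(·)⁻²`: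
`Q̂⁺′ = −2(ĥ∘σ − ĥ)/R`), `Q̂⁺(0) = q₀`. [cite: KontsevichZagier2001, §1.2] -/
theorem stub_wStepInst :
    ∀ (g₂ g₃ x₁ s₁ : ℝ) (f τp Qfp R σ Qhp : ℝ → ℝ)
      (T0' T0 : Literature.NumberTheory.Transcendental.KZ.IntegralRep 2)
      (rO : Literature.NumberTheory.Transcendental.KZ.IntegralRep 1),
    (∀ x, f x = 4 * x ^ 3 - g₂ * x - g₃) → IsAlgebraic ℚ g₂ → IsAlgebraic ℚ g₃ →
    IsAlgebraic ℚ x₁ → IsAlgebraic ℚ s₁ →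
    0 < x₁ → 0 < s₁ → s₁ ^ 2 * x₁ = 1 → (∀ x, x₁ ≤ x → 0 < f x) →
    (∀ s, 0 < s → s ≤ s₁ → Real.sqrt (f (s ^ 2)⁻¹) = R s / s ^ 3) →
    (∀ s ∈ Set.Icc 0 s₁, 0 < R s) → ContinuousOn R (Set.Icc 0 s₁) →
    IsSemialgebraicFunOn ℚ {t : Fin 1 → ℝ | t 0 ∈ Set.Icc 0 s₁} (fun t => R (t 0)) →
    (∀ s ∈ Set.Ioo 0 s₁, σ s ∈ Set.Ioo 0 s₁ ∧
      ∃ σ' : ℝ, HasDerivAt σ σ' s ∧ σ' ≠ 0 ∧ |σ'| * R s = R (σ s)) →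
    StrictAntiOn σ (Set.Icc 0 s₁) → Set.InjOn σ (Set.Ioo 0 s₁) → σ '' Set.Ioo 0 s₁ = Set.Ioo 0 s₁ →
    IsSemialgebraicFunOn ℚ {t : Fin 1 → ℝ | t 0 ∈ Set.Icc 0 s₁} (fun t => σ (t 0)) →
    (∀ s, 0 < s → s < s₁ → Qhp s = Qfp (s ^ 2)⁻¹ ∧ (σ s ^ 2)⁻¹ = τp (s ^ 2)⁻¹) →
    ContinuousOn Qhp (Set.Ico 0 s₁) →
    IsSemialgebraicFunOn ℚ {t : Fin 1 → ℝ | t 0 ∈ Set.Ico 0 s₁} (fun t => Qhp (t 0)) →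
    (∀ x, x₁ < x → HasDerivAt Qfp
      (((g₂ * τp x + 2 * g₃) / (4 * τp x ^ 2) - (g₂ * x + 2 * g₃) / (4 * x ^ 2)) / Real.sqrt (f x)) x) →
    T0'.domain = {z | 0 < z 1 ∧ z 1 < z 0 ∧ z 0 < s₁} →
    Set.EqOn T0'.integrand
      (fun z => (g₂ * (z 1) ^ 2 + 2 * g₃ * (z 1) ^ 4) / 4 * (2 / R (z 0)) * (2 / R (z 1))) T0'.domain →
    T0.domain = {z | 0 < z 0 ∧ z 0 < z 1 ∧ z 1 < s₁} →
    Set.EqOn T0.integrand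
      (fun z => (g₂ * (z 1) ^ 2 + 2 * g₃ * (z 1) ^ 4) / 4 * (2 / R (z 0)) * (2 / R (z 1))) T0.domain →
    rO.domain = {t | 0 < t 0 ∧ t 0 < s₁} →
    Set.EqOn rO.integrand (fun t => (Qhp 0 - Qhp (t 0)) * (2 / R (t 0))) rO.domain →
    Literature.NumberTheory.Transcendental.KZ.of T0 - Literature.NumberTheory.Transcendental.KZ.of T0'
      - Literature.NumberTheory.Transcendental.KZ.of rO ∈ Literature.NumberTheory.Transcendental.KZ.relations := by
  intro g₂ g₃ x₁ s₁ f τp Qfp R σ Qhp T0' T0 rO _hf h₂ h₃ _hx₁ hs₁a _hx₁0 _hs₁0 hsx _hfpos hR hRpos hRc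
    hRσ hσ hanti hσinj hσimg hσσ hchart hQc hQσ hQfp hSd hSi hTd hTi hOd hOi
  /- ## Pointwise facts along the chart translation `σ` -/
  have hσI : ∀ s ∈ Ioo 0 s₁, σ s ∈ Ioo 0 s₁ := fun s hs => (hσ s hs).1
  have hder : ∀ s ∈ Ioo 0 s₁, HasDerivAt σ (deriv σ s) s ∧
      2 / R (σ s) * |deriv σ s| = 2 / R s := fun s hs => by
    obtain ⟨hσs, σ', hσ', hne, hhaar⟩ := hσ s hs
    rw [hσ'.deriv]
    refine ⟨hσ', ?_⟩
    rw [← hhaar]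
    have h1 : |σ'| ≠ 0 := abs_ne_zero.2 hne
    have h2 : R s ≠ 0 := (hRpos s (Ioo_subset_Icc_self hs)).ne'
    field_simp
  /- ## The slab `S = {t | t 0 ∈ (0, s₁)}` of `ℝ¹` and the semialgebraic functions on it -/
  have hIcc : IsSemialgebraic ℚ {t : Fin 1 → ℝ | t 0 ∈ Icc 0 s₁} :=
    IsSemialgebraicFunOn.isSemialgebraic_holds hRσ
  have hIco : IsSemialgebraic ℚ {t : Fin 1 → ℝ | t 0 ∈ Ico 0 s₁} :=
    IsSemialgebraicFunOn.isSemialgebraic_holds hQσ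
  have hIoo : IsSemialgebraic ℚ {t : Fin 1 → ℝ | t 0 ∈ Ioo 0 s₁} := by
    have h_eq : {t : Fin 1 → ℝ | t 0 ∈ Ioo 0 s₁} = {t | (0 : ℝ) < t 0} ∩ {t | t 0 < s₁} :=
      Set.ext fun _ => Iff.rfl
    rw [h_eq]
    exact (KZ.isSemialgebraic_setOf_const_lt_apply isAlgebraic_zero 0).inter
      (KZ.isSemialgebraic_setOf_apply_lt_const hs₁a 0)
  have hsub : {t : Fin 1 → ℝ | t 0 ∈ Ioo 0 s₁} ⊆ {t : Fin 1 → ℝ | t 0 ∈ Icc 0 s₁} :=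
    fun t ht => Ioo_subset_Icc_self ht
  have hRne : ∀ t ∈ {t : Fin 1 → ℝ | t 0 ∈ Ioo 0 s₁}, R (t 0) ≠ 0 := fun t ht =>
    (hRpos _ (hsub ht)).ne'
  have hσS : IsSemialgebraicFunOn ℚ {t : Fin 1 → ℝ | t 0 ∈ Ioo 0 s₁} (fun t => σ (t 0)) :=
    hσσ.mono hsub hIoo
  have hRS : IsSemialgebraicFunOn ℚ {t : Fin 1 → ℝ | t 0 ∈ Ioo 0 s₁} (fun t => R (t 0)) :=
    hRσ.mono hsub hIoo
  have h2 : IsSemialgebraicFunOn ℚ {t : Fin 1 → ℝ | t 0 ∈ Ioo 0 s₁} (fun _ => (2 : ℝ)) :=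
    (isSemialgebraicFunOn_ratCast hIoo 2).congr fun x _ => by norm_num
  have h4 : IsSemialgebraicFunOn ℚ {t : Fin 1 → ℝ | t 0 ∈ Ioo 0 s₁} (fun _ => (4 : ℝ)) :=
    (isSemialgebraicFunOn_ratCast hIoo 4).congr fun x _ => by norm_num
  have hw : IsSemialgebraicFunOn ℚ {t : Fin 1 → ℝ | t 0 ∈ Ioo 0 s₁} (fun t => 2 / R (t 0)) :=
    h2.div hRS hRne
  have hX2 : IsSemialgebraicFunOn ℚ {t : Fin 1 → ℝ | t 0 ∈ Ioo 0 s₁} (fun t => t 0 ^ 2) :=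
    (isSemialgebraicFunOn_aeval hIoo (X 0 ^ 2)).congr fun t _ => by simp
  have hX4 : IsSemialgebraicFunOn ℚ {t : Fin 1 → ℝ | t 0 ∈ Ioo 0 s₁} (fun t => t 0 ^ 4) :=
    (isSemialgebraicFunOn_aeval hIoo (X 0 ^ 4)).congr fun t _ => by simp
  have hg₂ := isSemialgebraicFunOn_const_of_isAlgebraic hIoo h₂
  have hg₃ := isSemialgebraicFunOn_const_of_isAlgebraic hIoo h₃
  have hk : IsSemialgebraicFunOn ℚ {t : Fin 1 → ℝ | t 0 ∈ Ioo 0 s₁}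
      (fun t => (g₂ * t 0 ^ 2 + 2 * g₃ * t 0 ^ 4) / 4) :=
    ((IsSemialgebraicFunOn.add_holds (IsSemialgebraicFunOn.mul_holds hg₂ hX2)
      (IsSemialgebraicFunOn.mul_holds (IsSemialgebraicFunOn.mul_holds h2 hg₃) hX4)).div h4
      fun _ _ => four_ne_zero).congr fun t _ => rfl
  have hc0 : IsSemialgebraicFunOn ℚ {t : Fin 1 → ℝ | t 0 ∈ Ioo 0 s₁} (fun _ => (0 : ℝ)) :=
    (isSemialgebraicFunOn_ratCast hIoo 0).congr fun x _ => by norm_num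
  have hid : IsSemialgebraicFunOn ℚ {t : Fin 1 → ℝ | t 0 ∈ Ioo 0 s₁} (fun t => t 0) :=
    (isSemialgebraicFunOn_aeval hIoo (X 0)).congr fun t _ => by simp
  /- ## Bounds, signs, integrability -/
  have hkb : ∀ x ∈ Ioo 0 s₁, |(g₂ * x ^ 2 + 2 * g₃ * x ^ 4) / 4| ≤
      (|g₂| * s₁ ^ 2 + 2 * |g₃| * s₁ ^ 4) / 4 := by
    intro x hx
    have hx2 : x ^ 2 ≤ s₁ ^ 2 := pow_le_pow_left₀ hx.1.le hx.2.le 2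
    have hx4 : x ^ 4 ≤ s₁ ^ 4 := pow_le_pow_left₀ hx.1.le hx.2.le 4
    rw [abs_div, abs_of_pos (by norm_num : (0 : ℝ) < 4)]
    gcongr
    calc |g₂ * x ^ 2 + 2 * g₃ * x ^ 4| ≤ |g₂ * x ^ 2| + |2 * g₃ * x ^ 4| := abs_add_le _ _
      _ = |g₂| * x ^ 2 + 2 * |g₃| * x ^ 4 := by
          rw [abs_mul, abs_mul, abs_mul, abs_of_nonneg (pow_nonneg hx.1.le 2),
            abs_of_nonneg (pow_nonneg hx.1.le 4), abs_two]
      _ ≤ |g₂| * s₁ ^ 2 + 2 * |g₃| * s₁ ^ 4 := by gcongr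
  have hwnn : ∀ x ∈ Ioo 0 s₁, 0 ≤ 2 / R x := fun x hx =>
    div_nonneg zero_le_two (hRpos x (Ioo_subset_Icc_self hx)).le
  have hwint : IntegrableOn (fun s => 2 / R s) (Ioo 0 s₁) := by
    have hwc : ContinuousOn (fun s => 2 / R s) (Icc 0 s₁) :=
      continuousOn_const.div hRc fun s hs => (hRpos s hs).ne'
    exact hwc.integrableOn_Icc.mono_set Ioo_subset_Icc_self
  /- ## The fibres `(0, s)` and the potential `Q̂⁺` -/
  have hcd : ∀ x ∈ Ioo 0 s₁, (0 : ℝ) < x := fun x hx => hx.1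
  have hJcd : ∀ x ∈ Ioo 0 s₁, Icc 0 x ⊆ Ico 0 s₁ := fun x hx => Icc_subset_Ico_right hx.2
  have hBcd : ∀ x ∈ Ioo 0 s₁, Ioo 0 x ⊆ Ioo 0 s₁ := fun x hx => Ioo_subset_Ioo_right hx.2.le
  have hQc' : ∀ x ∈ Ioo 0 s₁, ContinuousOn Qhp (Icc 0 x) := fun x hx =>
    hQc.mono (Icc_subset_Ico_right hx.2)
  have hQd : ∀ x ∈ Ioo 0 s₁, ∀ x' ∈ Ioo 0 x, HasDerivAt Qhp
      (-(((g₂ * σ x' ^ 2 + 2 * g₃ * σ x' ^ 4) / 4 - (g₂ * x' ^ 2 + 2 * g₃ * x' ^ 4) / 4)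
        * (2 / R x'))) x' := fun x hx x' hx' =>
    wStepInst_hasDerivAt_chart hsx hR hRpos hσI hchart hQfp ⟨hx'.1, hx'.2.trans hx.2⟩
  /- ## The three representations -/
  have hSd' : T0'.domain = {z : Fin 2 → ℝ | z 0 ∈ Ioo 0 s₁ ∧ 0 < z 1 ∧ z 1 < z 0} := by
    rw [hSd]
    ext z
    simp only [mem_setOf_eq, mem_Ioo]
    constructor
    · rintro ⟨h1, h2, h3⟩
      exact ⟨⟨h1.trans h2, h3⟩, h1, h2⟩
    · rintro ⟨⟨-, h2⟩, h3, h4⟩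
      exact ⟨h3, h4, h2⟩
  have hTd' : T0.domain = (fun z : Fin 2 → ℝ => (![σ (z 0), σ (z 1)] : Fin 2 → ℝ)) '' T0'.domain := by
    rw [hTd, hSd']
    exact wStepInst_image_domain hanti hσimg
  have hOd' : rO.domain = {t : Fin 1 → ℝ | t 0 ∈ Ioo 0 s₁} := by
    rw [hOd]
    exact Set.ext fun _ => Iff.rfl
  /- ## One application of the generic translation step -/
  exact stub_translationStep σ (deriv σ) σ (deriv σ)
    (fun s => (g₂ * s ^ 2 + 2 * g₃ * s ^ 4) / 4) (fun s => (g₂ * s ^ 2 + 2 * g₃ * s ^ 4) / 4)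
    (fun s => 2 / R s) (fun s => 2 / R s) (fun s => 2 / R s) (fun s => 2 / R s)
    Qhp (fun _ => 0) (fun s => s) (Ioo 0 s₁) (Ioo 0 s₁) (Ioo 0 s₁) (Ioo 0 s₁) (Ico 0 s₁)
    ((|g₂| * s₁ ^ 2 + 2 * |g₃| * s₁ ^ 4) / 4) T0' T0 rO
    hIoo hIoo hIoo hIoo hIco hσS hσS hσinj hσinj hσI hσI hder hder hw hw hw hw hk hk hkb hkb
    hwnn hwnn hwint hwint hc0 hid hcd hJcd hBcd hQσ hQc' hQd hSd' hSi hTd' hTi hOd' hOi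

end Summit.KontsevichZagierPeriods.KontsevichZagierPeriods.Cruxes.NeronTorsionSector.Translation

end
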